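import Mathlib.Data.Fintype.Pigeonhole
import Mathlib.Order.Interval.Finset.Nat
import Mathlib.Topology.Algebra.Group.Pointwise
import Literature.AnabelianGeometry.AbsoluteAnabelian.GaloisSectionsFacts
import HarnessLib

/-!
# [GalSect] Lem. 3.1 (i) ⇔ (iv) as typed (FACT-LIST F-0101): the "limit of Galois sections" step in
# kernel, and the typed lemma PROVED at finite point data

S. Mochizuki, *Galois sections in absolute anabelian geometry*, Nagoya Math. J. 179 (2005) 17–45
[MochizukiGalSect2005]; locators `p.N` = kurims manuscript pages as in the trunk file (journal pages in
brackets): §3 p. 12–13 [p. 31], Lem. 3.1 p. 13 [p. 31–32].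

PROOF-ONLY companion (no definition, no instance, no structure) of `GaloisSectionsFacts.lean`
(abc-iut-L4-t16; imported, never edited), cell abc-iut, block F, seat abc-iut-f-096 (tranche 96, row
**F-0101** `GalSect.Lem_3_1_i_iff_iv`; class `preparatory`, kernel_closedness `parametrised`; sibling file
`GaloisSectionsFactsCor32Pointwise.lean` treats F-0100).  The universal closure of the row is refuted
(`GaloisSectionsFactsSchemaNegative.lean`, `not_forall_lem_3_1_i_iff_iv`): the predicate is a HYPOTHESIS on
free group data (policy θ, shape (1)), admissible at instances only.  What the kernel CAN say:

The print proof of (iv) ⇒ (i) [p. 32: "(ii) ⇒ (i) … Since the topological space `∏_j X_K[j,σ](K)` is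
compact … converge to a point `y_j` … `Im(σ)` is contained in the decomposition group `D_y` … `y` is not a
cusp, hence `Im(σ) = D_y`"] has a purely group-theoretic skeleton, proved here for EVERY extension
`1 → Δ → Π → G → 1` of profinite groups, every characteristic tower `Δ[j]` and every section `σ`:

* `IsCharacteristicTower.normal_map` — each `Δ[j]`, being characteristic in `Δ ⊴ Π`, is normal in `Π`, so
  that `Π[j,σ] = Im(σ)·Δ[j]` is the product SET (`coe_sectionNeighbourhood`) and is closed
  (`isClosed_sectionNeighbourhood`);
* `iInf_sectionNeighbourhood_eq_range` — **`⋂_j Π[j,σ] = Im(σ)`** (from `⋂_j Δ[j] = {1}`; Dedekind's law, no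
  compactness needed);
* `eq_range_of_le_range_of_surjectsOntoGal` / `range_eq_of_range_le_of_inf_geom_eq_bot` — the last step
  "`y` is not a cusp, hence `Im(σ) = D_y`": a subgroup of `Im(σ)` surjecting onto `G` is `Im(σ)`; a subgroup
  containing `Im(σ)` and meeting `Δ` trivially is `Im(σ)`;
* `exists_conj_smul_le_forall` — the compactness step: if conjugates of ONE subgroup `D` lie in `Π[j,σ]` for
  infinitely many `j`, a single conjugate lies in all of them (closed decreasing nonempty subsets of the
  compact group `Π`);
* `exists_range_eq_conj_smul_of_frequently` — **limit of Galois sections at a recurrent point**: if `D ↠ G`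
  and conjugates of `D` lie in `Π[j,σ]` for infinitely many `j`, then `Im(σ)` is a conjugate of `D`, i.e. (i);
* `lem_3_1_iv_imp_i_of_finite`, `lem_3_1_i_iff_iv_of_finite` — hence **the typed Lem. 3.1 HOLDS at every
  point datum with finitely many points all of which are algebraic** (pigeonhole supplies the recurrent
  point; (i) ⇒ (iv) is immediate for an algebraic point, `lem_3_1_i_imp_iv`).  What finiteness replaces is
  exactly the curve-theoretic input of print — compactness of `X_K(K)` ("a limit of points is a point") and,
  for (i) ⇒ (iv), Krasner's lemma (density of algebraic points) — which the abstract `PointData` does not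
  carry; `lem_3_1_i_iff_iv_of_isEmpty` is the pointless case.  (The degenerate instance `Δ = 1`, all
  `D_x = Π` is `lem_3_1_i_iff_iv_of_decomp_eq_top` in `CurveModelFactsNonVacuity.lean`; the present theorem
  covers arbitrary `Δ` and arbitrary closed `D_x`.)

HONEST FRAMING: statements about the cell's TYPED predicate over abstract profinite group data, proved by
elementary topological group theory; Lem. 3.1 itself (about hyperbolic curves over finite extensions of
`ℚ_p` defined over number fields) is a refereed, undisputed result that the tree types statements-first
(D-0014) and does not prove; no model of any curve is asserted to exist; typed ≠ proved; nothing here bears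
on the disputed [IUTchIII] Cor. 3.12; no side taken.
-/

noncomputable section

open scoped Classical Pointwise

namespace Literature.AnabelianGeometry.AbsoluteAnabelian.GalSect

open _root_.Topology

universe u

variable {E : FundamentalExtension.{u}}

/-! ### Surjecting onto `G_K` -/
/-- "`D` surjects onto `G_K`" unfolded: every element of `G` is the image of an element of `D`.
[cite: MochizukiGalSect2005, Lem 3.1 (iv) p.13] -/
theorem surjectsOntoGal_iff (D : Subgroup E.arith) :
    SurjectsOntoGal D ↔ ∀ t : E.gal, ∃ d ∈ D, E.aug d = t := by
  simp only [SurjectsOntoGal, Set.SurjOn, Set.univ_subset_iff, Set.eq_univ_iff_forall, Set.mem_image,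
    SetLike.mem_coe]

/-- Surjecting onto `G_K` is stable under `Π`-conjugation (decomposition groups are only defined up to
conjugation). [cite: MochizukiGalSect2005, Lem 3.1 (iv) p.13] -/
theorem SurjectsOntoGal.conj_smul {D : Subgroup E.arith} (h : SurjectsOntoGal D) (g : E.arith) :
    SurjectsOntoGal (MulAut.conj g • D) := by
  rw [surjectsOntoGal_iff] at h ⊢
  intro t
  obtain ⟨d, hd, hdt⟩ := h ((E.aug g)⁻¹ * t * E.aug g)
  refine ⟨g * d * g⁻¹, (Subgroup.mem_smul_pointwise_iff_exists _ _ _).mpr ⟨d, hd, rfl⟩, ?_⟩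
  simp only [map_mul, map_inv, hdt]
  group

/-- `g D g⁻¹ ↠ G_K` iff `D ↠ G_K`. [cite: MochizukiGalSect2005, Lem 3.1 (iv) p.13] -/
theorem surjectsOntoGal_conj_smul_iff (g : E.arith) (D : Subgroup E.arith) :
    SurjectsOntoGal (MulAut.conj g • D) ↔ SurjectsOntoGal D := by
  refine ⟨fun h => ?_, fun h => h.conj_smul g⟩
  have h' := h.conj_smul g⁻¹
  rwa [map_inv, inv_smul_smul] at h'

/-! ### F-0101, step 1: the tower `Π[j,σ]` — normality, product form, closedness (§3 p. 13) -/

/-- Each member `Δ[j]` of a characteristic tower of `Δ` is NORMAL in `Π`: conjugation by `π ∈ Π`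
restricts to a continuous automorphism of the normal subgroup `Δ`, under which `Δ[j]` is stable.
[cite: MochizukiGalSect2005, §3 p.13] -/
theorem IsCharacteristicTower.normal_map {Δj : ℕ → Subgroup E.geom} (hΔ : IsCharacteristicTower E Δj)
    (j : ℕ) : ((Δj j).map E.geom.subtype).Normal := by
  refine ⟨fun n hn π => ?_⟩
  obtain ⟨d, hd, rfl⟩ := hn
  let φ : E.geom ≃ₜ* E.geom :=
    { (MulAut.conjNormal π : E.geom ≃* E.geom) with
      continuous_toFun := continuous_induced_rng.2 (by
        show Continuous fun b : E.geom => ((MulAut.conjNormal π b : E.geom) : E.arith)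
        simp only [MulAut.conjNormal_apply]
        fun_prop)
      continuous_invFun := continuous_induced_rng.2 (by
        show Continuous fun b : E.geom => (((MulAut.conjNormal π).symm b : E.geom) : E.arith)
        simp only [MulAut.conjNormal_symm_apply]
        fun_prop) }
  have hφ : φ.toMonoidHom d ∈ Δj j := by
    have h := Subgroup.mem_map_of_mem φ.toMonoidHom hd
    rwa [hΔ.characteristic j φ] at h
  exact ⟨_, hφ, MulAut.conjNormal_apply π d⟩

/-- `Π[j,σ] = Im(σ) · Δ[j]` as a SUBSET of `Π` (the join is the product set, `Δ[j]` being normal in `Π`).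
[cite: MochizukiGalSect2005, §3 p.13] -/
theorem coe_sectionNeighbourhood {Δj : ℕ → Subgroup E.geom} (hΔ : IsCharacteristicTower E Δj)
    (σ : E.gal →ₜ* E.arith) (j : ℕ) :
    (sectionNeighbourhood σ Δj j : Set E.arith) =
      (σ.toMonoidHom.range : Set E.arith) * ((Δj j).map E.geom.subtype : Set E.arith) := by
  haveI := hΔ.normal_map j
  exact Subgroup.mul_normal _ _

/-- `Π[j,σ]` is closed in `Π` (product of the compact sets `Im(σ)` and `Δ[j]`); in print it is even open.
[cite: MochizukiGalSect2005, §3 p.13] -/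
theorem isClosed_sectionNeighbourhood {Δj : ℕ → Subgroup E.geom} (hΔ : IsCharacteristicTower E Δj)
    (σ : E.gal →ₜ* E.arith) (j : ℕ) : IsClosed (sectionNeighbourhood σ Δj j : Set E.arith) := by
  have hN : IsCompact (((Δj j).map E.geom.subtype : Subgroup E.arith) : Set E.arith) := by
    haveI : CompactSpace E.geom := isCompact_iff_compactSpace.mp E.isClosed_geom.isCompact
    rw [Subgroup.coe_map, Subgroup.coe_subtype]
    exact (Subgroup.isClosed_of_isOpen _ (hΔ.isOpen j)).isCompact.image continuous_subtype_val
  have hS : IsCompact ((σ.toMonoidHom.range : Subgroup E.arith) : Set E.arith) := by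
    rw [MonoidHom.coe_range]
    exact isCompact_range (map_continuous σ)
  rw [coe_sectionNeighbourhood hΔ σ j]
  exact (hS.mul hN).isClosed

/-! ### F-0101, step 2: `⋂_j Π[j,σ] = Im(σ)` -/

/-- **`⋂_j Π_{X_K}[j,σ] = Im(σ)`** for a characteristic tower (`⋂_j Δ_X[j] = {1}`) and a section `σ` of
`Π ↠ G`: if `π ∈ Im(σ)·Δ[j]` for every `j`, then `σ(aug π)⁻¹ · π ∈ Δ[j]` for every `j`, hence `= 1`.
[cite: MochizukiGalSect2005, §3 p.13] -/
theorem iInf_sectionNeighbourhood_eq_range {Δj : ℕ → Subgroup E.geom} (hΔ : IsCharacteristicTower E Δj)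
    (σ : E.gal →ₜ* E.arith) (hσ : ∀ g, E.aug (σ g) = g) :
    ⨅ j, sectionNeighbourhood σ Δj j = σ.toMonoidHom.range := by
  refine le_antisymm (fun π hπ => ?_) (le_iInf fun j => range_le_sectionNeighbourhood σ Δj j)
  have hmem : ∀ j, (σ (E.aug π))⁻¹ * π ∈ (Δj j).map E.geom.subtype := by
    intro j
    haveI := hΔ.normal_map j
    have hj : π ∈ σ.toMonoidHom.range ⊔ (Δj j).map E.geom.subtype := (Subgroup.mem_iInf.mp hπ) j
    obtain ⟨y, hy, z, hz, hyz⟩ := Subgroup.mem_sup_of_normal_right.mp hj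
    obtain ⟨t, ht⟩ := hy
    have ht' : σ t = y := ht
    have hz1 : E.aug z = 1 := by
      obtain ⟨d, -, rfl⟩ := hz
      exact E.mem_geom.mp d.2
    have haug : E.aug π = t := by
      rw [← hyz, ← ht', map_mul, hz1, mul_one, hσ]
    rw [haug, ← hyz, ← ht', inv_mul_cancel_left]
    exact hz
  have h1 : (σ (E.aug π))⁻¹ * π ∈ ⨅ j, (Δj j).map E.geom.subtype := Subgroup.mem_iInf.mpr hmem
  rw [← Subgroup.map_iInf E.geom.subtype (Subgroup.subtype_injective _) Δj, hΔ.iInf_eq_bot,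
    Subgroup.map_bot] at h1
  exact ⟨E.aug π, inv_mul_eq_one.mp (Subgroup.mem_bot.mp h1)⟩

/-! ### F-0101, step 3: "`y` is not a cusp, hence `Im(σ) = D_y`" -/

/-- A subgroup of `Im(σ)` that surjects onto `G_K` is all of `Im(σ)` (`aug` is injective on `Im(σ)`).
[cite: MochizukiGalSect2005, Lem 3.1 p.13] -/
theorem eq_range_of_le_range_of_surjectsOntoGal (σ : E.gal →ₜ* E.arith) (hσ : ∀ g, E.aug (σ g) = g)
    {H : Subgroup E.arith} (hle : H ≤ σ.toMonoidHom.range) (hsurj : SurjectsOntoGal H) :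
    H = σ.toMonoidHom.range := by
  refine le_antisymm hle fun y hy => ?_
  obtain ⟨t, ht⟩ := hy
  obtain ⟨h, hh, hht⟩ := (surjectsOntoGal_iff H).mp hsurj t
  obtain ⟨t', ht'⟩ := hle hh
  have ht'' : σ t' = h := ht'
  have htt : t' = t := by rw [← hσ t', ht'', hht]
  have hy' : y = h := by
    rw [← ht'', htt]
    exact ht.symm
  rw [hy']
  exact hh

/-- The print form of the last step of Lem. 3.1 (ii) ⇒ (i): if `Im(σ) ⊆ D` and `D ∩ Δ = {1}` ("`y` is
not a cusp": `I_y = D_y ∩ Δ_X` is trivial for a non-cusp, §1 p. 6), then `Im(σ) = D`.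
[cite: MochizukiGalSect2005, Lem 3.1 p.13] -/
theorem range_eq_of_range_le_of_inf_geom_eq_bot (σ : E.gal →ₜ* E.arith) (hσ : ∀ g, E.aug (σ g) = g)
    {D : Subgroup E.arith} (hle : σ.toMonoidHom.range ≤ D) (hD : D ⊓ E.geom = ⊥) :
    σ.toMonoidHom.range = D := by
  refine le_antisymm hle fun d hd => ?_
  have hs : σ (E.aug d) ∈ D := hle ⟨E.aug d, rfl⟩
  have h1 : (σ (E.aug d))⁻¹ * d ∈ D ⊓ E.geom := by
    refine Subgroup.mem_inf.mpr ⟨D.mul_mem (D.inv_mem hs) hd, E.mem_geom.mpr ?_⟩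
    rw [map_mul, map_inv, hσ, inv_mul_cancel]
  rw [hD] at h1
  exact ⟨E.aug d, inv_mul_eq_one.mp (Subgroup.mem_bot.mp h1)⟩

/-! ### F-0101, step 4: the compactness step and the limit theorem -/

/-- **Compactness step.** If, for every `k`, some conjugate of the subgroup `D ⊆ Π` lies in `Π[j,σ]` for
some `j ≥ k`, then ONE conjugate `g D g⁻¹` lies in `Π[j,σ]` for every `j`: the sets
`C_k = {g | g D g⁻¹ ⊆ Π[k,σ]}` are closed (`Π[k,σ]` is closed, conjugation continuous), nonempty and
decreasing in the compact group `Π`, so `⋂_k C_k ≠ ∅` (print: "since the topological space … is compact …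
converge"). [cite: MochizukiGalSect2005, Lem 3.1 p.13] -/
theorem exists_conj_smul_le_forall {Δj : ℕ → Subgroup E.geom} (hΔ : IsCharacteristicTower E Δj)
    (σ : E.gal →ₜ* E.arith) (D : Subgroup E.arith)
    (h : ∀ k : ℕ, ∃ j : ℕ, k ≤ j ∧ ∃ g : E.arith, MulAut.conj g • D ≤ sectionNeighbourhood σ Δj j) :
    ∃ g : E.arith, ∀ j : ℕ, MulAut.conj g • D ≤ sectionNeighbourhood σ Δj j := by
  let Cset : ℕ → Set E.arith := fun k => {g | MulAut.conj g • D ≤ sectionNeighbourhood σ Δj k}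
  have hanti : ∀ k, Cset (k + 1) ⊆ Cset k := fun k g hg =>
    le_trans (show MulAut.conj g • D ≤ _ from hg)
      (sectionNeighbourhood_antitone σ hΔ.antitone (Nat.le_succ k))
  have hne : ∀ k, (Cset k).Nonempty := fun k => by
    obtain ⟨j, hkj, g, hg⟩ := h k
    exact ⟨g, le_trans hg (sectionNeighbourhood_antitone σ hΔ.antitone hkj)⟩
  have hclosed : ∀ k, IsClosed (Cset k) := fun k => by
    have hC : Cset k =
        ⋂ d ∈ D, (fun g : E.arith => g * d * g⁻¹) ⁻¹' (sectionNeighbourhood σ Δj k : Set E.arith) := by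
      ext g
      refine ⟨fun hg => Set.mem_iInter₂.mpr fun d hd => ?_, fun hg => ?_⟩
      · have hg' : MulAut.conj g • D ≤ sectionNeighbourhood σ Δj k := hg
        exact hg' ((Subgroup.mem_smul_pointwise_iff_exists _ _ _).mpr ⟨d, hd, rfl⟩)
      · show MulAut.conj g • D ≤ sectionNeighbourhood σ Δj k
        intro x hx
        obtain ⟨d, hd, rfl⟩ := (Subgroup.mem_smul_pointwise_iff_exists _ _ _).mp hx
        exact Set.mem_iInter₂.mp hg d hd
    rw [hC]
    exact isClosed_biInter fun d _ => (isClosed_sectionNeighbourhood hΔ σ k).preimage (by fun_prop)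
  obtain ⟨g, hg⟩ := IsCompact.nonempty_iInter_of_sequence_nonempty_isCompact_isClosed Cset hanti hne
    (hclosed 0).isCompact hclosed
  exact ⟨g, fun j => Set.mem_iInter.mp hg j⟩

/-- **Limit of Galois sections at a recurrent point** (the group-theoretic skeleton of Lem. 3.1,
(iv) ⇒ (i), p. 13 / proof p. 14): let `D ⊆ Π` surject onto `G_K` (a decomposition group of a `K`-rational
point), and suppose that for infinitely many `j` some conjugate of `D` lies in `Π[j,σ]`.  Then `Im(σ)` IS a
conjugate of `D` — by the compactness step one conjugate lies in `⋂_j Π[j,σ] = Im(σ)`, and a subgroup of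
`Im(σ)` surjecting onto `G_K` is `Im(σ)`. [cite: MochizukiGalSect2005, Lem 3.1 p.13] -/
theorem exists_range_eq_conj_smul_of_frequently {Δj : ℕ → Subgroup E.geom}
    (hΔ : IsCharacteristicTower E Δj) (σ : E.gal →ₜ* E.arith) (hσ : ∀ g, E.aug (σ g) = g)
    (D : Subgroup E.arith) (hsurj : SurjectsOntoGal D)
    (h : ∀ k : ℕ, ∃ j : ℕ, k ≤ j ∧ ∃ g : E.arith, MulAut.conj g • D ≤ sectionNeighbourhood σ Δj j) :
    ∃ g : E.arith, σ.toMonoidHom.range = MulAut.conj g • D := by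
  obtain ⟨g, hg⟩ := exists_conj_smul_le_forall hΔ σ D h
  refine ⟨g, (eq_range_of_le_range_of_surjectsOntoGal σ hσ ?_ (hsurj.conj_smul g)).symm⟩
  rw [← iInf_sectionNeighbourhood_eq_range hΔ σ hσ]
  exact le_iInf hg

/-! ### F-0101, step 5: the typed Lem. 3.1 at finite point data -/

/-- **(iv) ⇒ (i) for point data with finitely many points** (any extension, any characteristic tower, any
section): by pigeonhole one point `y` serves condition (iv) for infinitely many `j`, and the limit theorem
gives `Im(σ) = g D_y g⁻¹`.  Neither algebraicity nor the cusp-avoidance hypothesis is used in this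
direction. [cite: MochizukiGalSect2005, Lem 3.1 p.13] -/
theorem lem_3_1_iv_imp_i_of_finite (P : PointData E) [Finite P.Point] {Δj : ℕ → Subgroup E.geom}
    (hΔ : IsCharacteristicTower E Δj) (σ : E.gal →ₜ* E.arith) (hσ : ∀ g, E.aug (σ g) = g)
    (hiv : ∀ j : ℕ, ∃ (x : P.Point) (g : E.arith), P.IsAlgebraic x ∧
      MulAut.conj g • P.decomp x ≤ sectionNeighbourhood σ Δj j ∧
        SurjectsOntoGal (MulAut.conj g • P.decomp x)) :
    ∃ (x : P.Point) (g : E.arith), σ.toMonoidHom.range = MulAut.conj g • P.decomp x := by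
  choose x g _halg hle hsurj using hiv
  obtain ⟨y, hy⟩ := Finite.exists_infinite_fiber x
  have hinf : (x ⁻¹' {y}).Infinite := Set.infinite_coe_iff.mp hy
  have hfreq : ∀ k : ℕ, ∃ j : ℕ, k ≤ j ∧ ∃ g' : E.arith,
      MulAut.conj g' • P.decomp y ≤ sectionNeighbourhood σ Δj j := by
    intro k
    obtain ⟨j, hj, hkj⟩ := hinf.exists_gt k
    have hxy : x j = y := hj
    refine ⟨j, hkj.le, g j, ?_⟩
    rw [← hxy]
    exact hle j
  obtain ⟨j₀, hj₀, -⟩ := hinf.exists_gt 0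
  have hxy₀ : x j₀ = y := hj₀
  have hsy : SurjectsOntoGal (P.decomp y) := by
    have hs := hsurj j₀
    rw [hxy₀] at hs
    exact (surjectsOntoGal_conj_smul_iff _ _).mp hs
  obtain ⟨g', hg'⟩ := exists_range_eq_conj_smul_of_frequently hΔ σ hσ (P.decomp y) hsy hfreq
  exact ⟨y, g', hg'⟩

/-- **(i) ⇒ (iv) for an algebraic point**: if `Im(σ) = g D_x g⁻¹` with `x` algebraic, then `g D_x g⁻¹`
itself lies in every `Π[j,σ] ⊇ Im(σ)` and surjects onto `G_K` (print's (i) ⇒ (iv) passes through Krasner's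
lemma because the rational point `x` need not be algebraic). [cite: MochizukiGalSect2005, Lem 3.1 p.13] -/
theorem lem_3_1_i_imp_iv (P : PointData E) (Δj : ℕ → Subgroup E.geom) (σ : E.gal →ₜ* E.arith)
    (hσ : ∀ g, E.aug (σ g) = g) {x : P.Point} {g : E.arith}
    (hx : σ.toMonoidHom.range = MulAut.conj g • P.decomp x) (halg : P.IsAlgebraic x) (j : ℕ) :
    ∃ (x : P.Point) (g : E.arith), P.IsAlgebraic x ∧
      MulAut.conj g • P.decomp x ≤ sectionNeighbourhood σ Δj j ∧
        SurjectsOntoGal (MulAut.conj g • P.decomp x) := by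
  refine ⟨x, g, halg, ?_, ?_⟩
  · rw [← hx]
    exact range_le_sectionNeighbourhood σ Δj j
  · rw [← hx]
    exact surjectsOntoGal_range σ hσ

/-- **FACT-LIST F-0101, instance form that HOLDS**: the typed Lem. 3.1 (i) ⇔ (iv) is TRUE for every
cuspidal datum and every point datum with FINITELY many points all of which are algebraic — over any
extension, for every characteristic tower and every section.  (A hyperbolic curve has infinitely many
closed points; finiteness stands in for the compactness of `X_K(K)` and the density of algebraic points used
in print.) [cite: MochizukiGalSect2005, Lem 3.1 p.13] -/
theorem lem_3_1_i_iff_iv_of_finite (C : E.CuspidalData) (P : PointData E) [Finite P.Point]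
    (halg : ∀ x, P.IsAlgebraic x) :
    Literature.AnabelianGeometry.AbsoluteAnabelian.GalSect.Lem_3_1_i_iff_iv C P := by
  intro Δj hΔ σ hσ _
  exact ⟨fun ⟨x, g, hx⟩ j => lem_3_1_i_imp_iv P Δj σ hσ hx (halg x) j,
    fun hiv => lem_3_1_iv_imp_i_of_finite P hΔ σ hσ hiv⟩

/-- The pointless case: with no (non-cuspidal) closed points declared, (i) and (iv) are both false, so the
typed equivalence holds. [cite: MochizukiGalSect2005, Lem 3.1 p.13] -/
theorem lem_3_1_i_iff_iv_of_isEmpty (C : E.CuspidalData) (P : PointData E) [IsEmpty P.Point] :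
    Literature.AnabelianGeometry.AbsoluteAnabelian.GalSect.Lem_3_1_i_iff_iv C P :=
  lem_3_1_i_iff_iv_of_finite C P fun x => isEmptyElim x

end Literature.AnabelianGeometry.AbsoluteAnabelian.GalSect
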